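import Literature.AnabelianGeometry.SemiGraphs.GeneralizedMorphisms

/-!
# [SemiAnbd] Remark 2.11.1, first assertion — proof companion to `GeneralizedMorphisms.lean`

Mochizuki, *Semi-graphs of anabelioids*, Publ. RIMS **42** (2006) 221–322, §2, author's manuscript
p. 32 [cite: MochizukiSemiAnbd2006, Rem. 2.11.1 p.32]: "It is immediate from the definitions that
every [non-generalized] morphism of semi-graphs of anabelioids determines a generalized morphism of
semi-graphs of anabelioids."

This file DISCHARGES the named fact `SemiGraphOfAnabelioids.remark_2_11_1_ofHom` of
`GeneralizedMorphisms.lean` (statements by abc-iut-L3-t1) by constructing, for a morphism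
`φ : 𝒢 → ℋ` ([SemiAnbd] Remark 2.4.2), the generalized morphism it determines (inside the proof; no
new definitions are introduced):

* `Cat(φ)` is the functor of path categories induced by the prefunctor of the underlying morphism
  of semi-graphs (`SemiGraph.Hom.catPrefunctor`: a vertex / edge goes to its image, the arrow
  `b : e → v` of a branch to the arrow `φ(b) : φ(e) → φ(v)`);
* `Φ_v := φ_v`, `Φ_e := φ_e`;
* over an identity, `Φ_𝟙` is the identity; over a branch arrow `b : e → v` it is the inverse of the
  2-isomorphism `φ_b` of Remark 2.4.2 (`Hom.φB`), re-indexed along `edgeOf (φ b) = φ e` (the only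
  bookkeeping: `branchFunctor_comp_φE`, proved by `subst`).

No new statements; proof-only companion (abc-iut cell, layer L3, DISCHARGE-C item C1).
-/

namespace Literature.AnabelianGeometry.SemiGraphs

open CategoryTheory
open Literature.AnabelianGeometry.Anabelioids

universe v₁ u₁ u

namespace SemiGraphOfAnabelioids

/-- Bookkeeping for Remark 2.11.1: the transported pull-back functor `branchFunctor` of the image
branch `φ b`, followed by `φ_e^*` indexed at an image edge `f`, is literally `(φ b)^* ⋙ φ_e^*` indexed
at `edgeOf (φ b)` once `f` is substituted. [cite: MochizukiSemiAnbd2006, Rem. 2.11.1 p.32] -/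
theorem Hom.branchFunctor_comp_φE {𝒢 ℋ : SemiGraphOfAnabelioids.{v₁, u₁, u}} (φ : Hom 𝒢 ℋ)
    (b : 𝒢.graph.Branch) (v : 𝒢.graph.Vertex) (hb : 𝒢.graph.abuts b = some v) (f : ℋ.graph.Edge)
    (pf : ℋ.graph.edgeOf (φ.base.branchMap b) = f) (p : φ.base.edgeMap (𝒢.graph.edgeOf b) = f) :
    branchFunctor (𝒢 := ℋ) (e := f) (v := φ.base.vertexMap v)
          ⟨φ.base.branchMap b, pf, φ.base.abuts_branchMap b v hb⟩ ⋙
        (φ.φE (𝒢.graph.edgeOf b) f p).pullback =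
      (ℋ.pull (φ.base.branchMap b) (φ.base.vertexMap v) (φ.base.abuts_branchMap b v hb)).pullback ⋙
        (φ.φE (𝒢.graph.edgeOf b) (ℋ.graph.edgeOf (φ.base.branchMap b))
          (φ.base.edgeOf_branchMap b).symm).pullback := by
  subst pf
  rfl

/-- In `Cat(𝔾)` no arrow ends at an edge. [cite: MochizukiSemiAnbd2006, Def. 2.11 p.32] -/
theorem _root_.Literature.AnabelianGeometry.SemiGraphs.SemiGraph.catArrow_toEdge_elim
    {G : SemiGraph.{u}} {c : G.CatCarrier} {e : G.Edge} (a : c ⟶ (Sum.inr e : G.CatCarrier)) :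
    False := by
  cases c <;> exact PEmpty.elim a

/-- DISCHARGE of the named fact `remark_2_11_1_ofHom` ([SemiAnbd] Remark 2.11.1, first assertion):
every morphism `φ` of semi-graphs of anabelioids determines a generalized morphism with the same
underlying maps on components — `Cat(φ)` is the path functor of `SemiGraph.Hom.catPrefunctor φ.base`,
`Φ_v = φ_v`, `Φ_e = φ_e`, and `Φ` over a branch arrow `b : e → v` is the inverse of the 2-isomorphism
`φ_b` of Remark 2.4.2 (over identities it is the identity; longer paths do not exist in `Cat(𝔾)`).
[cite: MochizukiSemiAnbd2006, Rem. 2.11.1 p.32] -/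
theorem remark_2_11_1_ofHom_holds : remark_2_11_1_ofHom.{v₁, u₁, u} := by
  intro 𝒢 ℋ φ
  -- (a) the functor `Cat(φ)`
  let F : 𝒢.graph.Cat ⥤ ℋ.graph.Cat :=
    Paths.lift (SemiGraph.Hom.catPrefunctor φ.base ⋙q Paths.of ℋ.graph.CatCarrier)
  -- (b) the components `Φ_c`
  let app : ∀ c : 𝒢.graph.CatCarrier,
      Anabelioids.Hom (𝒢.constituent c) (ℋ.constituent (F.obj c)) := fun c =>
    match c with
    | Sum.inl v => φ.φV v
    | Sum.inr e => φ.φE e (φ.base.edgeMap e) rfl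
  -- (c) the isomorphisms over a path ending in an arrow (necessarily a single branch arrow)
  let isoCons : ∀ {c c'' c' : 𝒢.graph.CatCarrier} (p : Quiver.Path c c'') (a : c'' ⟶ c'),
      atMap (F.map (p.cons a)) ⋙ (app c).pullback ≅ (app c').pullback ⋙ atMap (p.cons a) :=
    fun {c c'' c'} p a =>
    match c, c'', c', p, a with
    | _, Sum.inr _, Sum.inl v, .nil, ⟨b, rfl, hb⟩ =>
        eqToIso (φ.branchFunctor_comp_φE b v hb _ (by rw [φ.base.edgeOf_branchMap]) rfl) ≪≫
          (φ.φB b v hb).symm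
    | _, Sum.inr _, Sum.inl _, .cons _ a', _ => (SemiGraph.catArrow_toEdge_elim a').elim
    | _, Sum.inl _, Sum.inl _, _, a => PEmpty.elim a
    | _, Sum.inl _, Sum.inr _, _, a => PEmpty.elim a
    | _, Sum.inr _, Sum.inr _, _, a => PEmpty.elim a
  -- (c) over all paths
  let iso : ∀ {c c' : 𝒢.graph.CatCarrier} (f : Quiver.Path c c'),
      atMap (F.map f) ⋙ (app c).pullback ≅ (app c').pullback ⋙ atMap f :=
    fun {c c'} f =>
    match c', f with
    | _, .nil => Iso.refl _
    | _, .cons p a => isoCons p a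
  exact ⟨⟨F, app, iso, fun _ => rfl⟩, fun _ => rfl, fun _ => rfl⟩

end SemiGraphOfAnabelioids

end Literature.AnabelianGeometry.SemiGraphs
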